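import Mathlib
import Literature.LinearAlgebra.Matrix.PermanentSubperm
import Literature.Computability.AlgebraicComplexity.HessianAtOrigin
import Literature.Computability.AlgebraicComplexity.HessianRank
import Summits.ValiantsHypothesis.ValiantsHypothesis.Theses.UnpaddedGIT

/-!
# Route UnpaddedGIT — `QuadricSanity` (item stmt-ValiantsHypothesis-5764)

Closes the support item `QuadricSanity` of route `route-ValiantsHypothesis-UnpaddedGIT`
(sub-problem `ValiantsHypothesis`), the lower-side junk guard of the route's encoding: at
`n = 2`, `m = 1` the pencil-coefficient family `D_1(2)` is `{0}` (a `1 × 1` matrix of affine-linear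
forms has determinant of total degree `≤ 1`, so its degree-`2` component vanishes), and the
DISCRIMINANT of quaternary quadratic forms is an `SL_4`-invariant polynomial in the ten
coefficients that vanishes at `0` and not at the full-rank quadric `per_2 = x₀₀x₁₁ + x₀₁x₁₀`
(Bürgisser–Ikenmeyer 2017, Rem. 3.27; Weyl 1939).

## The proof

The witness `F` is the determinant of the GENERIC HESSIAN: the `σ × σ` matrix over the polynomial
ring of the coefficient space `(σ →₀ ℕ) → k` with entries `X_{eᵢ+eⱼ} · (eᵢ(j) + 1)` (the
coefficient variable of the monomial `xᵢxⱼ`, doubled on the diagonal), `σ = Fin 2 × Fin 2`.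
By `coeff_pderiv`, evaluating it at `coeffVec f` gives `det (hess0 f)`, the determinant of the
tree's Hessian-at-the-origin `hess0 f = ((∂ᵢ∂ⱼ f)(0))ᵢⱼ`
(`Literature/Computability/AlgebraicComplexity/HessianAtOrigin.lean`).

* Invariance.  `linSubst A` is the affine substitution `X t ↦ 0 + ∑ v, Aᵀ t v · X v`, so the
  tree's affine chain rule `hessianMatrix_aeval_C_add_linear` (Mignon–Ressayre, `HessianRank.lean`)
  gives `hess0 (linSubst A f) = A ⬝ hess0 f ⬝ Aᵀ` for EVERY polynomial `f`; taking determinants,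
  `det A = 1` gives invariance under `Matrix.SpecialLinearGroup` (the homogeneity hypothesis of
  the item is not even needed).
* Vanishing on `D_1(2) = {0}`: `det (hess0 0) = det 0 = 0`.
* Non-vanishing at `per_2`: `hess0 per_2` is the permutation matrix of the involution
  `x₀₀ ↔ x₁₁`, `x₀₁ ↔ x₁₀`, whose determinant is a sign, hence nonzero.

No new definitions: the witness is written inline (it is this file's only use).
-/

namespace Summit.ValiantsHypothesis.ValiantsHypothesis.Theorems.UnpaddedGIT

open MvPolynomial
open Literature.Computability.AlgebraicComplexity

section Hessian

variable {σ : Type*} {k : Type*} [Field k]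

/-- The Hessian at the origin is the Hessian matrix evaluated at `0`:
`hess0 f = hessianMatrix f 0` (both are tree notions; `eval 0 = constantCoeff`). -/
theorem hess0_eq_hessianMatrix_zero (f : MvPolynomial σ k) : hess0 f = hessianMatrix f 0 := by
  ext s t
  rw [hess0_apply, hessianMatrix_apply, MvPolynomial.eval_zero]

/-- Entries of the Hessian at the origin from coefficients:
`(∂ᵢ∂ⱼ f)(0) = coeff (eᵢ + eⱼ) f · (eᵢ(j) + 1)` (i.e. `2·coeff(2eᵢ)` on the diagonal,
`coeff(eᵢ+eⱼ)` off it). -/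
theorem hess0_apply_eq_coeff (f : MvPolynomial σ k) (i j : σ) :
    hess0 f i j = coeff (Finsupp.single i 1 + Finsupp.single j 1) f *
      (((Finsupp.single i 1 : σ →₀ ℕ) j : k) + 1) := by
  rw [hess0_apply, constantCoeff_eq, coeff_pderiv, zero_add, coeff_pderiv]
  simp

variable [Fintype σ]

/-- `linSubst A` is the affine substitution `X t ↦ C 0 + ∑ v, C (Aᵀ t v) * X v` (the shape
consumed by `hessianMatrix_aeval_C_add_linear`). -/
theorem linSubst_eq_aeval_affine (A : Matrix σ σ k) :
    linSubst σ k A =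
      aeval (fun t => C ((0 : σ → k) t) + ∑ v, C (A.transpose t v) * X v) := by
  apply MvPolynomial.algHom_ext
  intro i
  simp [linSubst_X, smul_eq_C_mul]

/-- **Transformation law of the Hessian at the origin** under linear substitution:
`hess0 (linSubst A f) = A ⬝ hess0 f ⬝ Aᵀ` for every polynomial `f` (affine chain rule of
Mignon–Ressayre at the point `0`, which `linSubst A` fixes). -/
theorem hess0_linSubst (A : Matrix σ σ k) (f : MvPolynomial σ k) :
    hess0 (linSubst σ k A f) = A * hess0 f * A.transpose := by
  rw [hess0_eq_hessianMatrix_zero, hess0_eq_hessianMatrix_zero, linSubst_eq_aeval_affine,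
    hessianMatrix_aeval_C_add_linear]
  simp only [Matrix.transpose_transpose, Pi.zero_apply, mul_zero, Finset.sum_const_zero, add_zero]
  rfl

variable [DecidableEq σ]

/-- The determinant of the Hessian at the origin is invariant under linear substitution by
matrices of determinant `1`: `det (A H Aᵀ) = det A · det H · det A = det H`. -/
theorem det_hess0_linSubst (g : Matrix.SpecialLinearGroup σ k) (f : MvPolynomial σ k) :
    (hess0 (linSubst σ k (g : Matrix σ σ k) f)).det = (hess0 f).det := by
  rw [hess0_linSubst, Matrix.det_mul, Matrix.det_mul, Matrix.det_transpose, g.det_coe]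
  simp

/-- Evaluating the GENERIC HESSIAN DETERMINANT (the discriminant, a polynomial in the
coefficient variables `X_d`, `d : σ →₀ ℕ`, written inline) at the coefficient vector of `f`
gives `det (hess0 f)`. -/
theorem aeval_coeffVec_det_genericHessian (f : MvPolynomial σ k) :
    aeval (coeffVec f) (Matrix.det (Matrix.of fun i j : σ =>
      (X (Finsupp.single i 1 + Finsupp.single j 1) *
        C (((Finsupp.single i 1 : σ →₀ ℕ) j : k) + 1) : MvPolynomial (σ →₀ ℕ) k))) =
      (hess0 f).det := by
  rw [AlgHom.map_det]
  congr 1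
  ext i j
  simp [hess0_apply_eq_coeff]

end Hessian

section PerTwo

variable {k : Type*} [Field k]

/-- `per_2 = x₀₀ x₁₁ + x₀₁ x₁₀`. -/
theorem perPoly_fin_two :
    perPoly (Fin 2) k = X (0, 0) * X (1, 1) + X (0, 1) * X (1, 0) := by
  simp [perPoly, Matrix.permanent_fin_two_row, Matrix.mvPolynomialX]

/-- The Hessian of `per_2` is the permutation matrix of the involution `x₀₀ ↔ x₁₁`,
`x₀₁ ↔ x₁₀` of the four variables. -/
theorem hess0_perPoly_fin_two :
    hess0 (perPoly (Fin 2) k) =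
      (1 : Matrix (Fin 2 × Fin 2) (Fin 2 × Fin 2) k).submatrix
        (Equiv.swap ((0 : Fin 2), (0 : Fin 2)) (1, 1) * Equiv.swap ((0 : Fin 2), (1 : Fin 2)) (1, 0))
        id := by
  rw [perPoly_fin_two]
  ext i j
  rcases i with ⟨i₁, i₂⟩
  rcases j with ⟨j₁, j₂⟩
  fin_cases i₁ <;> fin_cases i₂ <;> fin_cases j₁ <;> fin_cases j₂ <;>
    simp [hess0_apply, pderiv_X, Matrix.one_apply, Equiv.swap_apply_def]

/-- The discriminant does not vanish at `per_2`: `det (hess0 per_2)` is the sign of a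
permutation. -/
theorem det_hess0_perPoly_fin_two_ne_zero : (hess0 (perPoly (Fin 2) k)).det ≠ 0 := by
  rw [hess0_perPoly_fin_two, Matrix.det_permute, Matrix.det_one, mul_one]
  rcases Int.units_eq_one_or
    (Equiv.Perm.sign (Equiv.swap ((0 : Fin 2), (0 : Fin 2)) (1, 1) *
      Equiv.swap ((0 : Fin 2), (1 : Fin 2)) (1, 0))) with h | h <;> simp [h]

end PerTwo

/-- **`QuadricSanity` holds** (support item stmt-ValiantsHypothesis-5764 of route `UnpaddedGIT`):
the discriminant of quaternary quadratic forms — the determinant of the generic Hessian in the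
coefficient variables — is invariant under `Matrix.SpecialLinearGroup (Fin 2 × Fin 2) ℂ` acting by
linear substitution (on all polynomials, in particular on degree-`2` forms), vanishes on the
pencil-coefficient family `D_1(2) = {0}`, and is nonzero at `per_2`
(Bürgisser–Ikenmeyer 2017, Rem. 3.27). -/
theorem quadricSanity_proof :
    Summit.ValiantsHypothesis.ValiantsHypothesis.Theses.UnpaddedGIT.QuadricSanity := by
  unfold Summit.ValiantsHypothesis.ValiantsHypothesis.Theses.UnpaddedGIT.QuadricSanity
  refine ⟨Matrix.det (Matrix.of fun i j : Fin 2 × Fin 2 =>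
      (X (Finsupp.single i 1 + Finsupp.single j 1) *
        C (((Finsupp.single i 1 : Fin 2 × Fin 2 →₀ ℕ) j : ℂ) + 1) :
          MvPolynomial ((Fin 2 × Fin 2) →₀ ℕ) ℂ)), ?_, ?_, ?_⟩
  · intro g f _hf
    rw [aeval_coeffVec_det_genericHessian, aeval_coeffVec_det_genericHessian, det_hess0_linSubst]
  · intro A hA
    have hdet : A.det = A 0 0 := Matrix.det_fin_one A
    have hzero : MvPolynomial.homogeneousComponent 2 A.det = 0 := by
      rw [hdet]
      exact homogeneousComponent_eq_zero _ _ (lt_of_le_of_lt (hA 0 0) (by norm_num))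
    rw [hzero, aeval_coeffVec_det_genericHessian, map_zero]
    exact Matrix.det_zero
  · rw [aeval_coeffVec_det_genericHessian]
    exact det_hess0_perPoly_fin_two_ne_zero

end Summit.ValiantsHypothesis.ValiantsHypothesis.Theorems.UnpaddedGIT
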